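import Literature.MathematicalPhysics.QuantumFieldTheory.Balaban1983to89.B5Identities197
import Literature.MathematicalPhysics.QuantumFieldTheory.Balaban1983to89.Beta.FluctuationProjection

/-!
# `Balaban1983to89.B5Identities197Torus` — T. Bałaban, *Propagators and renormalization transformations
# for lattice gauge theories. I*, Commun. Math. Phys. **95** (1984) 17–40 [Balaban1984PropagatorsI]:
# (1.95), (1.97), (1.98), (1.106)/(1.107) of Sect. E FOR THE CONCRETE TORUS OPERATORS — the abstract
# algebra `B5Identities197.Ops.Laws`/`Ops.Adj` DISCHARGED on the typed model (kind «model-instance»)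

statement-level skeleton of published theorems with citation tags; proofs where landed; nothing here is a claim about the Yang–Mills mass gap

PDF held: `paper:balaban1984-cmp95-propagators-rt-i` (journal page = PDF page + 16); pp. 25–26, 33–35
re-read this session (OCR p0009–p0010, p0017–p0019).

WHAT IS REPRODUCED.  SKELETON row **B5.Eq1.97** (+ B5.Eq1.95, B5.Eq1.93/(1.98), B5.Eq1.107) of
`run/shared/lean/pub/lit-balaban/SKELETON.md`; Phase-2 seat **p21** of `PHASE2-TARGETS.md` §G.3 (cell
`lit-balaban`, unit `lit-balaban-p21`, HOME `run/shared/lean/pub/lit-balaban/`).  The decls of record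
`B5Identities197.eq197_left/eq197_right` (+ `eq195_*`, `eq198`, `proj107_*`) are proved ABSTRACTLY over a
bundle `Ops` of complex matrices with law blocks `Ops.Laws`/`Ops.Adj`; this file builds the instance
`opsTorus n M a` on the fine torus `T_η = Tor (fine n M)` (`η = 1/n`) over the unit torus `Tor M` (any `d`,
`n ≥ 1`, `M_μ ≥ 1`, `a > 0`) — `D := GradOp (fine n M) n` (∂), `Ds := Dᴴ` (∂*), `Lap := LapS (fine n M) n`,
`K := ½(CurlOp)ᴴCurlOp` (∂*∂ on vector functions), `Q := QvOp n M` (Q_k), `Qs := QvAdj n M = n^d·Qᴴ` (Q_k*),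
`Q' := QsOp n M` (Q′_k), `D₁ := GradOp M 1` (∂₁), `Da := DeltaA n M a` (Δ_a), `G := (DeltaA n M a)⁻¹`,
**`R := RT n M := 1 − PcT n M n − Pker (fine n M) n`** (the orthogonal projection onto `ΔN(Q′_k)`, p. 25) —
proves `opsTorus_laws`/`opsTorus_adj` from LANDED kernel facts, and reads off for the concrete operators
**(1.97)** `R∂*G∂ = R`, `∂*G∂R = R` (`eq197_left/right`), **(1.95)** (`eq195_left/right`), **(1.98)**
(`eq198`), `R² = R`, and **(1.107)**: the abstract `proj107` at `E := (QGQ*)⁻¹` IS the β cell's concrete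
`Beta.FluctuationProjection.Pproj` (`proj107_eq_Pproj`), whence the Δ_a-orthogonality in vector form
(`proj107_orth`) and «(1.106) solves (1.105)» (`proj107_solves_105`).

ON `R` (load-bearing; the one deviation from the letter of the §G.3 line, which writes `R := 1 − PcT`).
p. 25: «The projection operator R has a clear meaning. It is an orthogonal projection on the linear
subspace ΔN(Q′_k) of L²(T_η), N(Q′_k) = {λ : Q′_kλ = 0}. Indeed RΔλ = Δλ if Q′_kλ = 0, and if Rω = ω then
… ω = Δλ and Q′_kλ = 0»; pp. 29–30, (1.69)–(1.70): «R = I − P», «The configuration ∂*A is orthogonal to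
constant functions and on such configurations the operator P is given by the formula (1.70)».  On the
finite torus `1 − PcT` (the tree's `Δ⁻¹` is zero on constants) FIXES the constants, so it is the p. 25
projection on `1^⊥` only; on all of `L²(T_η)` that projection is `(1 − PcT)(1 − P_const) = RT` (`RT_eq_mul`,
`RT_mulVec_eq_self_iff`; cf. `B5Projector144.printed_clause_fails` and the β cell's
`Beta.LandauMultiplierIdentities.R_div_G_grad_R : (1 − PcT)∂*G∂(1 − PcT) = 1 − PcT − Pker`, i.e. `= RT`).
For the literal `R := 1 − PcT` the law `r_range` and (1.97) are FALSE on constants (§6), and `RT` is the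
ONLY `R` with `Laws ∧ Adj` on this model (§5).  Every printed USE of `R` is `R∂*` or `∂R`, where both
readings agree (`RT_mul_GradOp_adjoint`, `GradOp_mul_RT`): the tree's gauge condition `(1 − PcT)∂*A = 0` is
`RT∂*A = 0`, and `DeltaA` (typed with `1 − PcT`) obeys (1.69) with `RT` (`DeltaA_eq_curl_RT`).  GAPS.md (p21).

INPUTS are LANDED kernel facts imported by name (INTERFACES.md §2.P P-21 / R3; nothing re-derived) from
`B5DeltaA169`, `B5Action121`, `B5Value126`, `B5LaplaceInverse`, `B5Prop11Lattice`,
`Beta.VectorPropagatorDict` ((1.55)), `Beta.LandauMultiplierIdentities`, `Beta.FluctuationProjection`; each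
docstring names its own.  AGREEMENT with the β cell (same operators, `G` written `calG`, `R` written `1 − PcT`
next to `∂*`): `eq195_left_dict` rewrites our (1.95) into `Beta.LandauMultiplierIdentities.R_div_G_QvAdj_eq_zero`
symbol for symbol; `proj107_eq_Pproj` identifies (1.107), so `QP = 0`, `R∂*P = 0`, `P² = P`, uniqueness and
`a`-independence are that module's theorems (not restated).  The derivations used here are the ABSTRACT ones
of `B5Identities197`; the β cell's road (apply ∂* to Δ_aA = J) is an independent kernel proof.
NOT CLAIMED: (1.94), (1.96), the Lagrange systems (1.91)/(1.92), (1.104)/(1.105) as typed objects; infinite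
lattice; the Gaussian integrals (1.64)–(1.68).  Value = the skeleton's abstract Sect. E algebra shown
NON-VACUOUS and EQUAL to B5's typed torus operators; NOT summit progress.
-/

noncomputable section

open scoped BigOperators Matrix ComplexConjugate

namespace Literature.MathematicalPhysics.QuantumFieldTheory.Balaban1983to89.B5Identities197Torus

open B5Prop11Plancherel (Tor fine calG)
open B5Action121 B5Block118 B5LaplaceInverse B5Value126 B5DeltaA169
open Beta.VectorPropagatorDict (ext_of_mulVec' QvOp_mul_GradOp)
open Beta.LandauMultiplierIdentities (CurlOp_mul_GradOp PcT_mul_Pker sum_Pker_mulVec)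
open Beta.FluctuationProjection (Pker_mul_GradOp_adjoint QGQ QGQ_mul_inv Pproj Hk)

section Defs

variable {d : ℕ} (n : ℕ) [NeZero n] (M : Fin d → ℕ) [hM : ∀ μ, NeZero (M μ)]

/-! ## §1 `R` = the orthogonal projection onto `ΔN(Q′_k)` (p. 25), written with `P` of (1.70) -/

/-- **`R`** on all of `L²(T_η)`: `R := 1 − P − P_const`, `P = PcT = Δ⁻¹Q′*(Q′Δ⁻²Q′*)⁻¹Q′Δ⁻¹` ((1.70)),
`P_const = Pker` the orthogonal projection onto the constants — «R = I − P» of (1.69) on the configurations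
«orthogonal to constant functions» (p. 30), `0` on constants: «an orthogonal projection on the linear
subspace ΔN(Q′_k) of L²(T_η)» (p. 25). [cite: Balaban1984PropagatorsI, p.25, (1.69)–(1.70) pp.29–30] -/
def RT : Matrix (Tor (fine n M)) (Tor (fine n M)) ℂ :=
  1 - PcT n M (n : ℂ) - Pker (fine n M) (n : ℂ)

/-- «orthogonal»: `Rᴴ = R`. [cite: Balaban1984PropagatorsI, p.25] -/
theorem RT_conjTranspose : (RT n M)ᴴ = RT n M := by
  rw [RT, Matrix.conjTranspose_sub, Matrix.conjTranspose_sub, Matrix.conjTranspose_one,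
    PcT_conjTranspose, Pker_conjTranspose]

/-- `R = (I − P)(I − P_const)`: «R = I − P» on «configurations … orthogonal to constant functions», `0` on
constants. [cite: Balaban1984PropagatorsI, (1.69) p.29, p.30] -/
theorem RT_eq_mul : RT n M = (1 - PcT n M (n : ℂ)) * (1 - Pker (fine n M) (n : ℂ)) := by
  rw [RT, Matrix.mul_sub, Matrix.mul_one, Matrix.sub_mul, Matrix.one_mul, PcT_mul_Pker, sub_zero]

/-- **`R∂* = (I − P)∂*`**: in front of a divergence («∂*A is orthogonal to constant functions») the p. 25
projection and `I − P` of (1.70) agree — the tree's gauge condition `(1 − PcT)∂*A = 0` is `R∂*A = 0`.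
[cite: Balaban1984PropagatorsI, (1.69) p.29, p.30] -/
theorem RT_mul_GradOp_adjoint :
    RT n M * (GradOp (fine n M) (n : ℂ))ᴴ = (1 - PcT n M (n : ℂ)) * (GradOp (fine n M) (n : ℂ))ᴴ := by
  rw [RT, Matrix.sub_mul, Pker_mul_GradOp_adjoint, sub_zero]

/-- **`∂R = ∂(I − P)`**: behind a gradient the two readings of `R` agree as well (∂ kills constants).
[cite: Balaban1984PropagatorsI, (1.69) p.29, p.30] -/
theorem GradOp_mul_RT :
    GradOp (fine n M) (n : ℂ) * RT n M = GradOp (fine n M) (n : ℂ) * (1 - PcT n M (n : ℂ)) := by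
  have h := congrArg Matrix.conjTranspose (Pker_mul_GradOp_adjoint n M)  -- `∂·P_const = 0`
  rw [Matrix.conjTranspose_mul, Matrix.conjTranspose_conjTranspose, Pker_conjTranspose,
    Matrix.conjTranspose_zero] at h
  rw [RT, Matrix.mul_sub, h, sub_zero]

/-- `(I − P)1 = 1`: the formula (1.70), extended by the pseudo-inverse `Δ⁻¹`, FIXES the constant `1`.
[folklore] -/
private theorem oneSubPcT_mulVec_one :
    (1 - PcT n M (n : ℂ)) *ᵥ (fun _ : Tor (fine n M) => (1 : ℂ)) = fun _ => 1 := by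
  rw [Matrix.sub_mulVec, Matrix.one_mulVec, PcT_mulVec, LapSinv_const]
  simp only [Matrix.mulVec_zero, sub_zero]

/-- p. 25 «Indeed RΔλ = Δλ if Q′_kλ = 0» — for `R = RT`, on all of `L²(T_η)` (the law `Ops.Laws.r_fix`).
[cite: Balaban1984PropagatorsI, p.25] -/
theorem RT_mulVec_LapS_of_ker (l : Tor (fine n M) → ℂ) (hl : QsOp n M *ᵥ l = 0) :
    RT n M *ᵥ (LapS (fine n M) (n : ℂ) *ᵥ l) = LapS (fine n M) (n : ℂ) *ᵥ l := by
  have hc : (n : ℂ) ≠ 0 := Nat.cast_ne_zero.mpr (NeZero.ne n)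
  have hl0 : ∑ x, l x = 0 := by  -- `N(Q′_k) ⊥ 1`: the block sums of `l` vanish
    have h := B5Blocks16.sum_QsOp n M l
    rw [hl] at h
    simp only [Pi.zero_apply, Finset.sum_const_zero] at h
    exact (mul_eq_zero.mp h.symm).resolve_left (one_div_ne_zero (pow_ne_zero _ hc))
  rw [RT, Matrix.sub_mulVec, Matrix.sub_mulVec, Matrix.one_mulVec,
    Pker_orth (fine n M) hc _ (B5DivOrth.sum_LapS (fine n M) (n : ℂ) l), sub_zero, PcT_mulVec,
    LapSinv_LapS_of_orth (fine n M) hc l hl0, hl]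
  simp only [Matrix.mulVec_zero, sub_zero]

/-- p. 25 «if Rω = ω then … ω = Δλ and Q′_kλ = 0», in the strong form of `Ops.Laws.r_range`: EVERY `Rw`
is a `Δλ` with `Q′_kλ = 0` (`λ = λ₀(w − P_const w)`, `λ₀` of p. 22). [cite: Balaban1984PropagatorsI, p.25, p.22] -/
theorem RT_mulVec_eq_LapS (w : Tor (fine n M) → ℂ) :
    ∃ l : Tor (fine n M) → ℂ, QsOp n M *ᵥ l = 0 ∧ RT n M *ᵥ w = LapS (fine n M) (n : ℂ) *ᵥ l := by
  have hc : (n : ℂ) ≠ 0 := Nat.cast_ne_zero.mpr (NeZero.ne n)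
  obtain ⟨b, hb⟩ : ∃ b, b = w - Pker (fine n M) (n : ℂ) *ᵥ w := ⟨_, rfl⟩
  have hb0 : ∑ x, b x = 0 := by
    simp only [hb, Pi.sub_apply, Finset.sum_sub_distrib, sum_Pker_mulVec, sub_self]
  refine ⟨lambda0 n M (n : ℂ) b, QsOp_lambda0 n M (n : ℂ) hc b, ?_⟩
  have hres := residual_lambda0 n M (n : ℂ) hc b hb0
  have hPK : PcT n M (n : ℂ) *ᵥ (Pker (fine n M) (n : ℂ) *ᵥ w) = 0 := by
    rw [Matrix.mulVec_mulVec, PcT_mul_Pker, Matrix.zero_mulVec]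
  calc RT n M *ᵥ w = b - PcT n M (n : ℂ) *ᵥ b := by
        rw [RT, Matrix.sub_mulVec, Matrix.sub_mulVec, Matrix.one_mulVec, hb, Matrix.mulVec_sub, hPK,
          sub_zero]
        abel
    _ = LapS (fine n M) (n : ℂ) *ᵥ lambda0 n M (n : ℂ) b := by rw [← hres]; abel

/-- **p. 25, the whole sentence, for `R = RT`**: «an orthogonal projection on the linear subspace ΔN(Q′_k)
… RΔλ = Δλ if Q′_kλ = 0, and if Rω = ω then … ω = Δλ and Q′_kλ = 0» — the fixed space of `RT` is EXACTLY
`ΔN(Q′_k)` (for `1 − PcT` it is `ΔN(Q′_k) ⊕ ℂ·1`). [cite: Balaban1984PropagatorsI, p.25] -/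
theorem RT_mulVec_eq_self_iff (w : Tor (fine n M) → ℂ) :
    RT n M *ᵥ w = w ↔ ∃ l : Tor (fine n M) → ℂ, QsOp n M *ᵥ l = 0 ∧ w = LapS (fine n M) (n : ℂ) *ᵥ l := by
  constructor
  · intro h
    obtain ⟨l, hl, hw⟩ := RT_mulVec_eq_LapS n M w
    exact ⟨l, hl, h.symm.trans hw⟩
  · rintro ⟨l, hl, rfl⟩
    exact RT_mulVec_LapS_of_ker n M l hl

/-- «projection»: `R² = R`. [cite: Balaban1984PropagatorsI, p.25] -/
theorem RT_mul_RT : RT n M * RT n M = RT n M :=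
  ext_of_mulVec' fun w => by
    obtain ⟨l, hl, hw⟩ := RT_mulVec_eq_LapS n M w
    rw [← Matrix.mulVec_mulVec, hw, RT_mulVec_LapS_of_ker n M l hl]

/-! ## §2 The instance of `B5Identities197.Ops` on the torus operators -/

/-- the B5 torus operators of Sects. C–E bundled as `B5Identities197.Ops`, the gauge projection a parameter
`R` (`RT` in `opsTorus`; `1 − PcT` in §6): `D = ∂`, `Ds = ∂ᴴ`, `Lap = Δ`, `K = ∂*∂ = ½(CurlOp)ᴴCurlOp`, `Q = Q_k`,
`Qs = Q_k* = n^d·Q_kᴴ`, `Q' = Q′_k`, `D₁ = ∂₁`, `Da = Δ_a`, `G = Δ_a⁻¹`. [cite: Balaban1984PropagatorsI, (1.69) p.29] -/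
def opsWith (R : Matrix (Tor (fine n M)) (Tor (fine n M)) ℂ) (a : ℝ) :
    B5Identities197.Ops (Tor (fine n M)) (Tor (fine n M) × Fin d) (Tor M) (Tor M × Fin d) where
  D := GradOp (fine n M) (n : ℂ)
  Ds := (GradOp (fine n M) (n : ℂ))ᴴ
  Lap := LapS (fine n M) (n : ℂ)
  K := (1 / 2 : ℂ) • ((CurlOp (fine n M) (n : ℂ))ᴴ * CurlOp (fine n M) (n : ℂ))
  R := R
  Q := QvOp n M
  Qs := QvAdj n M
  Q' := QsOp n M
  D₁ := GradOp M 1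
  a := (a : ℂ)
  Da := DeltaA n M a
  G := (DeltaA n M a)⁻¹

/-- **the concrete model of B5 Sect. E**: `opsWith` at `R := RT`, the orthogonal projection onto `ΔN(Q′_k)`.
[cite: Balaban1984PropagatorsI, p.25, (1.69) p.29, (1.71) p.30] -/
def opsTorus (a : ℝ) :
    B5Identities197.Ops (Tor (fine n M)) (Tor (fine n M) × Fin d) (Tor M) (Tor M × Fin d) :=
  opsWith n M (RT n M) a

end Defs

section Main

variable {d : ℕ} (n : ℕ) [NeZero n] (hn : 1 ≤ n) (M : Fin d → ℕ) [hM : ∀ μ, NeZero (M μ)] (a : ℝ)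
  (ha : 0 < a)

/-- **(1.69) with the p. 25 projection**: `Δ_a = ∂*∂ + ∂R∂* + aQ*Q` holds with `R = RT` for the typed `Δ_a`
(which is written with `1 − PcT`), since `∂·P_const·∂* = 0`. [cite: Balaban1984PropagatorsI, (1.69) p.29] -/
theorem DeltaA_eq_curl_RT :
    DeltaA n M a
      = (1 / 2 : ℂ) • ((CurlOp (fine n M) (n : ℂ))ᴴ * CurlOp (fine n M) (n : ℂ))
        + GradOp (fine n M) (n : ℂ) * RT n M * (GradOp (fine n M) (n : ℂ))ᴴ
        + (a : ℂ) • (QvAdj n M * QvOp n M) := by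
  rw [Matrix.mul_assoc (GradOp (fine n M) (n : ℂ)) (RT n M), RT_mul_GradOp_adjoint, ← Matrix.mul_assoc]
  exact DeltaA_eq_curl n M a

include hn ha in
/-- **`Ops.Laws` DISCHARGED for the torus operators**, every law a landed kernel fact ((1.69) `DeltaA_eq_curl`,
`CurlOp_mul_GradOp`, `GradOp_conjTranspose_mul_GradOp`, (1.55) `QvOp_mul_GradOp`, p. 25 `RT_mulVec_*`,
(1.71) `isUnit_DeltaA`). [cite: Balaban1984PropagatorsI, (1.69) p.29, (1.55) p.27, p.25, (1.71) p.30] -/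
theorem opsTorus_laws : (opsTorus n M a).Laws where
  da_eq := DeltaA_eq_curl_RT n M a
  curl_grad := by
    show ((1 / 2 : ℂ) • ((CurlOp (fine n M) (n : ℂ))ᴴ * CurlOp (fine n M) (n : ℂ)))
      * GradOp (fine n M) (n : ℂ) = 0
    rw [Matrix.smul_mul, Matrix.mul_assoc, CurlOp_mul_GradOp, Matrix.mul_zero, smul_zero]
  div_grad := GradOp_conjTranspose_mul_GradOp (fine n M) (n : ℂ)
  q_grad := QvOp_mul_GradOp n M
  r_fix := RT_mulVec_LapS_of_ker n M
  r_range := RT_mulVec_eq_LapS n M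
  g_da := Matrix.nonsing_inv_mul _ ((Matrix.isUnit_iff_isUnit_det _).mp (isUnit_DeltaA n hn M a ha))
  da_g := Matrix.mul_nonsing_inv _ ((Matrix.isUnit_iff_isUnit_det _).mp (isUnit_DeltaA n hn M a ha))

include hn ha in
/-- **`Ops.Adj` DISCHARGED for the torus operators**: «The operator G is a symmetric operator» (Prop. 1.1;
`B5Prop11Lattice.DeltaA_inv_isHermitian`), `R` orthogonal (`RT_conjTranspose`), `∂* = ∂ᴴ`, `Q* = n^d·Qᴴ`
(`B5DeltaA169.QvAdj`). [cite: Balaban1984PropagatorsI, Prop. 1.1 p.33, p.25, (1.21) p.21, (1.74) p.30] -/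
theorem opsTorus_adj : (opsTorus n M a).Adj where
  g_herm := (B5Prop11Lattice.DeltaA_inv_isHermitian n hn M a ha).eq
  r_herm := RT_conjTranspose n M
  ds_eq := rfl
  qs_eq := ⟨(n : ℝ) ^ d, by
    show QvAdj n M = (((n : ℝ) ^ d : ℝ) : ℂ) • (QvOp n M)ᴴ
    rw [Complex.ofReal_pow, Complex.ofReal_natCast]; rfl⟩

/-! ## §3 (1.97), (1.95), (1.98) for the concrete operators -/

include hn ha in
/-- **(1.97), left form, for the torus operators: `R∂*G∂ = R`** (`G = Δ_a⁻¹`, `R` the orthogonal projection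
onto `ΔN(Q′_k)`). [cite: Balaban1984PropagatorsI, (1.97) p.34] -/
theorem eq197_left :
    RT n M * (GradOp (fine n M) (n : ℂ))ᴴ * (DeltaA n M a)⁻¹ * GradOp (fine n M) (n : ℂ) = RT n M :=
  B5Identities197.eq197_left (X := opsTorus n M a) (opsTorus_laws n hn M a ha) (opsTorus_adj n hn M a ha)

include hn ha in
/-- **(1.97), right form, for the torus operators: `∂*G∂R = R`.** [cite: Balaban1984PropagatorsI, (1.97) p.34] -/
theorem eq197_right :
    (GradOp (fine n M) (n : ℂ))ᴴ * (DeltaA n M a)⁻¹ * GradOp (fine n M) (n : ℂ) * RT n M = RT n M :=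
  B5Identities197.eq197_right (X := opsTorus n M a) (opsTorus_laws n hn M a ha)

include hn ha in
/-- **(1.95), first identity, for the torus operators: `R∂*GQ* = 0`.**
[cite: Balaban1984PropagatorsI, (1.95) p.33] -/
theorem eq195_left :
    RT n M * (GradOp (fine n M) (n : ℂ))ᴴ * (DeltaA n M a)⁻¹ * QvAdj n M = 0 :=
  B5Identities197.eq195_left (X := opsTorus n M a) (opsTorus_laws n hn M a ha) (opsTorus_adj n hn M a ha)

include hn ha in
/-- **(1.95), second identity, for the torus operators: `QG∂R = 0`.**
[cite: Balaban1984PropagatorsI, (1.95) p.33] -/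
theorem eq195_right :
    QvOp n M * (DeltaA n M a)⁻¹ * GradOp (fine n M) (n : ℂ) * RT n M = 0 :=
  B5Identities197.eq195_right (X := opsTorus n M a) (opsTorus_laws n hn M a ha)

include hn ha in
/-- DICTIONARY (agreement with the β cell): our `R∂*GQ*` IS the matrix `(1 − PcT)·∂ᴴ·calG·QvAdj` of
`Beta.LandauMultiplierIdentities.R_div_G_QvAdj_eq_zero`, symbol for symbol (and `QG∂R` is its
`QvOp·calG·∂·(1 − PcT)` by `GradOp_mul_RT`). [cite: Balaban1984PropagatorsI, (1.95) p.33] -/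
theorem eq195_left_dict :
    RT n M * (GradOp (fine n M) (n : ℂ))ᴴ * (DeltaA n M a)⁻¹ * QvAdj n M
      = (1 - PcT n M (n : ℂ)) * (GradOp (fine n M) (n : ℂ))ᴴ * calG n hn M a ha * QvAdj n M := by
  rw [RT_mul_GradOp_adjoint, calG_eq_DeltaA_inv n hn M a ha]

include hn ha in
/-- **(1.98)** «The equalities (1.95), (1.97) imply that the second equation in (1.93) has the form
Rλ = λ = 0. Thus we have A = −GQ*ω», torus operators. [cite: Balaban1984PropagatorsI, (1.93) p.33, (1.98) p.34] -/
theorem eq198 (ω : Tor M × Fin d → ℂ) (l : Tor (fine n M) → ℂ) (hRl : RT n M *ᵥ l = l)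
    (h193 : RT n M *ᵥ ((GradOp (fine n M) (n : ℂ))ᴴ *ᵥ ((DeltaA n M a)⁻¹ *ᵥ (QvAdj n M *ᵥ ω)))
        + RT n M *ᵥ ((GradOp (fine n M) (n : ℂ))ᴴ *ᵥ ((DeltaA n M a)⁻¹ *ᵥ (GradOp (fine n M) (n : ℂ) *ᵥ l)))
        = 0) :
    l = 0 ∧ -((DeltaA n M a)⁻¹ *ᵥ (QvAdj n M *ᵥ ω)) - (DeltaA n M a)⁻¹ *ᵥ (GradOp (fine n M) (n : ℂ) *ᵥ l)
        = -((DeltaA n M a)⁻¹ *ᵥ (QvAdj n M *ᵥ ω)) :=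
  B5Identities197.eq198 (X := opsTorus n M a) (opsTorus_laws n hn M a ha) (opsTorus_adj n hn M a ha)
    ω l hRl h193

/-! ## §4 (1.106)/(1.107): the abstract `proj107` IS the β cell's concrete `Pproj` -/

include hn ha in
/-- (1.100)/(1.102): `(QGQ*)⁻¹` right-inverts `Q·Δ_a⁻¹·Q*` (`Beta.FluctuationProjection.QGQ_mul_inv`) — the
hypothesis `hE` of `B5Identities197.q_proj107`/`proj107_idem`. [cite: Balaban1984PropagatorsI, (1.102) p.34] -/
theorem QGQ_rightInv :
    QvOp n M * (DeltaA n M a)⁻¹ * QvAdj n M * (QGQ n hn M a ha)⁻¹ = 1 := by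
  rw [← calG_eq_DeltaA_inv n hn M a ha]
  exact QGQ_mul_inv n hn M a ha

include hn ha in
/-- **(1.107) `P = I − G∂R∂* − GQ*(QGQ*)⁻¹Q` on the torus**: the abstract `B5Identities197.proj107` of the
model at `E := (QGQ*)⁻¹` IS `Beta.FluctuationProjection.Pproj` (whose `QvOp_mul_Pproj`, `R_div_Pproj`,
`Pproj_mul_Pproj`, `Pproj_mul_of_mem`, `Pproj_unique`, `Pproj_indep` are then `QP = 0`, `R∂*P = 0`, `P² = P`,
`P = id` on the subspace, uniqueness, `a`-independence). [cite: Balaban1984PropagatorsI, (1.107) p.35] -/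
theorem proj107_eq_Pproj :
    B5Identities197.proj107 (opsTorus n M a) (QGQ n hn M a ha)⁻¹ = Pproj n hn M a ha := by
  show 1 - (DeltaA n M a)⁻¹ * GradOp (fine n M) (n : ℂ) * RT n M * (GradOp (fine n M) (n : ℂ))ᴴ
        - (DeltaA n M a)⁻¹ * QvAdj n M * (QGQ n hn M a ha)⁻¹ * QvOp n M
      = 1 - calG n hn M a ha * GradOp (fine n M) (n : ℂ) * (1 - PcT n M (n : ℂ))
          * (GradOp (fine n M) (n : ℂ))ᴴ
        - calG n hn M a ha * QvAdj n M * (QGQ n hn M a ha)⁻¹ * QvOp n M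
  rw [← calG_eq_DeltaA_inv n hn M a ha, Matrix.mul_assoc _ (RT n M), RT_mul_GradOp_adjoint,
    ← Matrix.mul_assoc]

include hn ha in
/-- **Δ_a-orthogonality of (1.106)** («an orthogonal projection in the metric ⟨A, Δ_aA⟩ on the subspace of
A satisfying the conditions QA = 0, R∂*A = 0»), vector form, for the torus operators: for `A₀` with
`QA₀ = 0`, `R∂*A₀ = 0` and every `A`, `⟨A₀, Δ_a(A − PA)⟩ = 0`.
[cite: Balaban1984PropagatorsI, p.34, (1.106) p.35] -/
theorem proj107_orth (A A₀ : Tor (fine n M) × Fin d → ℂ) (hQ : QvOp n M *ᵥ A₀ = 0)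
    (hR : RT n M *ᵥ ((GradOp (fine n M) (n : ℂ))ᴴ *ᵥ A₀) = 0) :
    star A₀ ⬝ᵥ (DeltaA n M a *ᵥ (A - Pproj n hn M a ha *ᵥ A)) = 0 := by
  rw [← proj107_eq_Pproj n hn M a ha]
  exact B5Identities197.proj107_orth (X := opsTorus n M a) (opsTorus_laws n hn M a ha)
    (opsTorus_adj n hn M a ha) _ A A₀ hQ hR

include hn ha in
/-- **(1.106) solves (1.105)** for the torus operators: with `ω := (QGQ*)⁻¹QA`, `λ := R∂*A`, `A₀ := PA`,
`Δ_aA₀ − Δ_aA + Q*ω + ∂λ = 0`, `QA₀ = 0`, `R∂*A₀ = 0`.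
[cite: Balaban1984PropagatorsI, (1.105)–(1.106) pp.34–35] -/
theorem proj107_solves_105 (A : Tor (fine n M) × Fin d → ℂ) :
    DeltaA n M a *ᵥ (Pproj n hn M a ha *ᵥ A) - DeltaA n M a *ᵥ A
          + QvAdj n M *ᵥ ((QGQ n hn M a ha)⁻¹ *ᵥ (QvOp n M *ᵥ A))
          + GradOp (fine n M) (n : ℂ) *ᵥ (RT n M *ᵥ ((GradOp (fine n M) (n : ℂ))ᴴ *ᵥ A)) = 0
      ∧ QvOp n M *ᵥ (Pproj n hn M a ha *ᵥ A) = 0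
      ∧ RT n M *ᵥ ((GradOp (fine n M) (n : ℂ))ᴴ *ᵥ (Pproj n hn M a ha *ᵥ A)) = 0 := by
  rw [← proj107_eq_Pproj n hn M a ha]
  exact B5Identities197.proj107_solves_105 (X := opsTorus n M a) (opsTorus_laws n hn M a ha)
    (opsTorus_adj n hn M a ha) _ (QGQ_rightInv n hn M a ha) A

/-! ## §5 `R` is determined: `RT` is the only gauge projection with `Laws ∧ Adj` on this model -/

/-- **uniqueness of `R`**: if `B5Identities197`'s `Laws` and `Adj` hold for the torus operators with SOME
gauge projection `R`, then `R = RT` (the two p. 25 sentences and «orthogonal» pin `R` down: `RT·R = R`,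
`R·RT = RT`, adjoints). [cite: Balaban1984PropagatorsI, p.25] -/
theorem R_eq_RT_of_laws {R : Matrix (Tor (fine n M)) (Tor (fine n M)) ℂ} (hL : (opsWith n M R a).Laws)
    (hA : (opsWith n M R a).Adj) : R = RT n M := by
  have h1 : RT n M * R = R := ext_of_mulVec' fun w => by
    obtain ⟨l, hl, hw⟩ := hL.r_range w
    have hl' : QsOp n M *ᵥ l = 0 := hl
    have hw' : R *ᵥ w = LapS (fine n M) (n : ℂ) *ᵥ l := hw
    rw [← Matrix.mulVec_mulVec, hw', RT_mulVec_LapS_of_ker n M l hl']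
  have h2 : R * RT n M = RT n M := ext_of_mulVec' fun w => by
    obtain ⟨l, hl, hw⟩ := RT_mulVec_eq_LapS n M w
    have hfix : R *ᵥ (LapS (fine n M) (n : ℂ) *ᵥ l) = LapS (fine n M) (n : ℂ) *ᵥ l := hL.r_fix l hl
    rw [← Matrix.mulVec_mulVec, hw, hfix]
  have hR : Rᴴ = R := hA.r_herm
  have h3 : R * RT n M = R := by
    have h := congrArg Matrix.conjTranspose h1
    rwa [Matrix.conjTranspose_mul, RT_conjTranspose, hR] at h
  rw [← h3, h2]

/-! ## §6 The literal `R := I − P` on all of `L²(T_η)`: no `Laws`, and (1.97) fails on the constants -/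

/-- with `R := 1 − PcT` («R = I − P» of (1.70) taken on ALL of `L²(T_η)`) the law `r_range` fails —
`(I − P)1 = 1` is not a `Δλ` — so `B5Identities197.Ops.Laws` does NOT hold for that reading (abstractly:
`B5Projector144.printed_clause_fails`). [cite: Balaban1984PropagatorsI, p.25, (1.70) p.30] -/
theorem not_laws_oneSubPcT : ¬ (opsWith n M (1 - PcT n M (n : ℂ)) a).Laws := by
  intro hL
  obtain ⟨l, -, hl⟩ := hL.r_range (fun _ => 1)
  have hl' : (1 - PcT n M (n : ℂ)) *ᵥ (fun _ => (1 : ℂ)) = LapS (fine n M) (n : ℂ) *ᵥ l := hl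
  have hs := congrArg (fun f : Tor (fine n M) → ℂ => ∑ x, f x) hl'
  simp only [oneSubPcT_mulVec_one, B5DivOrth.sum_LapS, Finset.sum_const, Finset.card_univ, nsmul_eq_mul,
    mul_one] at hs
  exact (Nat.cast_ne_zero.mpr Fintype.card_ne_zero) hs

/-- … and **(1.97) `∂*G∂R = R` is FALSE for `R := 1 − PcT`** on the finite torus: on the constant `1` the two
sides give `0` resp. `1`; with the p. 25 projection `RT` it holds (`eq197_right`).
[cite: Balaban1984PropagatorsI, (1.97) p.34, p.25] -/
theorem divGgrad_oneSubPcT_ne :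
    (GradOp (fine n M) (n : ℂ))ᴴ * (DeltaA n M a)⁻¹ * GradOp (fine n M) (n : ℂ) * (1 - PcT n M (n : ℂ))
      ≠ 1 - PcT n M (n : ℂ) := by
  intro h
  have h2 : GradOp (fine n M) (n : ℂ) *ᵥ (fun _ : Tor (fine n M) => (1 : ℂ)) = 0 := by
    funext ⟨x, ν⟩
    rw [GradOp_mulVec, B5LaplaceSpectral.sdiff_const]
    rfl
  have h3 : (((GradOp (fine n M) (n : ℂ))ᴴ * (DeltaA n M a)⁻¹ * GradOp (fine n M) (n : ℂ)
      * (1 - PcT n M (n : ℂ))) *ᵥ fun _ : Tor (fine n M) => (1 : ℂ)) 0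
      = ((1 - PcT n M (n : ℂ)) *ᵥ fun _ : Tor (fine n M) => (1 : ℂ)) 0 := by rw [h]
  rw [← Matrix.mulVec_mulVec, ← Matrix.mulVec_mulVec, ← Matrix.mulVec_mulVec, oneSubPcT_mulVec_one, h2,
    Matrix.mulVec_zero, Matrix.mulVec_zero, Pi.zero_apply] at h3
  exact one_ne_zero h3.symm

end Main

end Literature.MathematicalPhysics.QuantumFieldTheory.Balaban1983to89.B5Identities197Torus

end
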